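import Mathlib.Analysis.InnerProductSpace.PiL2
import Mathlib.Analysis.InnerProductSpace.Laplacian
import Mathlib.Analysis.Calculus.Gradient.Basic
import Mathlib.MeasureTheory.Integral.Bochner.Basic
import Mathlib.MeasureTheory.Measure.Haar.OfBasis
import Literature.Analysis.FluidPDE.ClassicalSolution
import HarnessLib

/-!
# The scalar dissipation factor of a drift on a parabolic cylinder (`DissipatesAtScale`)

Topic `Literature/Analysis/FluidPDE`. Requested by route `SelfMixingDichotomy` of
`NavierStokesRegularity` (items `stmt-NavierStokesRegularity-1421/1422/1423`), where the predicate
below is inlined verbatim as `MIX(u, T, x₀, r, δ)`.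

Let `u : ℝ → ℝ³ → ℝ³` be a (time-dependent) drift, `T` a final time, `x₀ ∈ ℝ³`, `r` a parabolic
scale and `δ` a factor. On the time window `S = [T − r², T − r²/2]` (the first half of the last
diffusive time `r²` before `T`, diffusivity `1` = viscosity) consider smooth, uniformly rapidly
decaying scalars `θ : ℝ → ℝ³ → ℝ` solving the advection–diffusion equation

  `∂ₜθ + u·∇θ = Δθ` on `S × ℝ³`

(one-sided time derivative within `S`, the convention of `IsClassicalNSSolutionOn`) whose datum
`θ(T − r²)` is supported in the ball `B_r(x₀)`. The drift **dissipates at scale `r` with factor `δ`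
at `(T, x₀)`** if every such `θ` has lost all but a fraction `δ` of its (whole-space) `L²` norm
after half a diffusive time:

  `∫ θ(T − r²/2)² ≤ δ² ∫ θ(T − r²)²`.

This is a localised (parabolic cylinder, finite window, prescribed factor `δ`, compactly supported
data, whole space) form of the inequality `‖θ(t)‖_{L²} ≤ e^{-1} ‖θ(s)‖_{L²} for all data` that
defines the *dissipation time* of a time-dependent incompressible drift (Feng–Iyer 2019, §1,
continuous-time `τ_d`, following Fannjiang–Wołowski; Coti Zelati–Delgadino–Elgindi 2020, §1), the
quantitative counterpart of *relaxation-enhancing* flows (Constantin–Kiselev–Ryzhik–Zlatoš 2008,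
Definition 1.1: `‖φ^A(·,τ) − φ̄‖_{L²} < δ` for all unit data once the amplitude `A` is large) and
of *dissipation-enhancing* flows (Zlatoš 2010). Small `δ` at scale `r` means that `u`
quantitatively enhances dissipation of scalars at that scale; since the total `L²` norm on `ℝ³` is
used, rigid sweeping and solid rotation do not lower the factor.

## Main definitions and results

* `DissipatesAtScale u T x₀ r δ`: the predicate above, **definitionally equal** to the formula
  inlined in the route items (`dissipatesAtScale_iff` is `Iff.rfl`), so that those items can be
  restated with the named predicate without change of meaning.
* `DissipatesAtScale.mono_sq`, `DissipatesAtScale.mono`: monotonicity in the factor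
  (`δ² ≤ δ'²`, resp. `0 ≤ δ ≤ δ'`).
* `dissipatesAtScale_abs`, `dissipatesAtScale_neg`: only `δ²` enters.
* `DissipatesAtScale.congr`: the predicate only sees the drift on the window `S × ℝ³`.
* `dissipatesAtScale_zero_radius`: at scale `r = 0` the condition is vacuous-true (the datum is
  supported in the empty ball).

## Design notes

* The solution class is exactly the one of the route: `IsSmoothSpaceTimeOn S θ` (joint `C^∞` on
  `S × ℝ³`), `HasUniformRapidDecayOn S θ` (uniform Schwartz bounds, under which the energy
  identity holds), the pointwise equation with `timeDerivWithin S`, Mathlib's `gradient` and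
  `Laplacian.laplacian` (`Δ`), and `Function.support (θ (T − r²)) ⊆ Metric.ball x₀ r`.
* No sign or size condition on `r`, `δ` is built in (the route quantifies `r ∈ (0, r₀)`, `0 < δ`);
  degenerate parameters give degenerate but documented meanings (`dissipatesAtScale_zero_radius`,
  `dissipatesAtScale_neg`).
* The integrals are Bochner integrals over Lebesgue measure on `EuclideanSpace ℝ (Fin 3)`
  (`measureSpaceOfInnerProductSpace`); for `θ` in the stated class both integrands are integrable,
  so no junk value is hit inside the class.
* Deliberately NOT here: the energy inequality `DissipatesAtScale u T x₀ r 1` for divergence-free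
  drifts, Galilean/rotation invariance, the pure-heat benchmark constant, and a variable-viscosity
  version (window `r²/ν`, diffusivity `ν`); the route works at `ν = 1` and rescales.

## References

* P. Constantin, A. Kiselev, L. Ryzhik, A. Zlatoš, *Diffusion and mixing in fluid flow*, Ann. of
  Math. 168 (2008), 643–674, Definition 1.1 (relaxation-enhancing flows), Theorem 1.2.
  [ConstantinEtAl2008]
* A. Zlatoš, *Diffusion in fluid flow: dissipation enhancement by flows in 2D*, Comm. PDE 35
  (2010), 496–534, §1. [Zlatos2010]
* Y. Feng, G. Iyer, *Dissipation enhancement by mixing*, Nonlinearity 32 (2019), 1810–1851, §1,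
  Definition 1 (dissipation time of a pulsed diffusion) and the continuous-time dissipation time
  `τ_d` of a divergence-free drift. [FengIyer2019]
* M. Coti Zelati, M. G. Delgadino, T. M. Elgindi, *On the relation between enhanced dissipation
  timescales and mixing rates*, Comm. Pure Appl. Math. 73 (2020), 1205–1244, §1.
  [ZelatiDelgadinoElgindi2019]
-/

noncomputable section

open MeasureTheory Set Function
open scoped Laplacian InnerProductSpace RealInnerProductSpace

namespace Literature.Analysis.FluidPDE

/-- **Scalar dissipation factor of a drift on a parabolic cylinder.** `DissipatesAtScale u T x₀ r δ`
(the route's `MIX(u, T, x₀, r, δ)`): with `S = [T − r², T − r²/2]`, every scalar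
`θ : ℝ → ℝ³ → ℝ` that is jointly smooth on `S × ℝ³` (`IsSmoothSpaceTimeOn`), has uniform rapid
decay there (`HasUniformRapidDecayOn`), solves `∂ₜθ + ⟪u, ∇θ⟫ = Δθ` pointwise on `S × ℝ³`
(time derivative within `S`) and starts from a datum `θ(T − r²)` supported in `Metric.ball x₀ r`
satisfies `∫ θ(T − r²/2)² ≤ δ² · ∫ θ(T − r²)²`: the drift lets at most the fraction `δ` of the
`L²` norm of any scale-`r` blob at `x₀` survive half a diffusive time (diffusivity `1`). A
localised, finite-window, factor-`δ` form of the dissipation-time inequality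
`‖θ(t)‖ ≤ e^{-1}‖θ(s)‖` for all data (Feng–Iyer 2019, §1, continuous-time `τ_d`), i.e. of
quantitative relaxation enhancement (Constantin–Kiselev–Ryzhik–Zlatoš 2008, Def. 1.1). No
conditions on `r`, `δ` are imposed here (the users quantify `0 < r`, `0 < δ`).
[cite: FengIyer2019, §1, continuous-time dissipation time τ_d (localised finite-window variant)] -/
def DissipatesAtScale (u : ℝ → EuclideanSpace ℝ (Fin 3) → EuclideanSpace ℝ (Fin 3)) (T : ℝ)
    (x₀ : EuclideanSpace ℝ (Fin 3)) (r δ : ℝ) : Prop :=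
  ∀ θ : ℝ → EuclideanSpace ℝ (Fin 3) → ℝ,
    IsSmoothSpaceTimeOn (Set.Icc (T - r ^ 2) (T - r ^ 2 / 2)) θ →
    HasUniformRapidDecayOn (Set.Icc (T - r ^ 2) (T - r ^ 2 / 2)) θ →
    (∀ t ∈ Set.Icc (T - r ^ 2) (T - r ^ 2 / 2), ∀ x : EuclideanSpace ℝ (Fin 3),
      timeDerivWithin (Set.Icc (T - r ^ 2) (T - r ^ 2 / 2)) θ t x + inner ℝ (u t x) (gradient (θ t) x)
        = Laplacian.laplacian (θ t) x) →
    Function.support (θ (T - r ^ 2)) ⊆ Metric.ball x₀ r →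
    ∫ x, (θ (T - r ^ 2 / 2) x) ^ 2 ≤ δ ^ 2 * ∫ x, (θ (T - r ^ 2) x) ^ 2

variable {u u' : ℝ → EuclideanSpace ℝ (Fin 3) → EuclideanSpace ℝ (Fin 3)} {T : ℝ}
  {x₀ : EuclideanSpace ℝ (Fin 3)} {r δ δ' : ℝ}

/-- Unfolding of `DissipatesAtScale`, literally the formula inlined in the items of route
`SelfMixingDichotomy` (so restating them with the named predicate is `Iff.rfl`). [folklore] -/
theorem dissipatesAtScale_iff :
    DissipatesAtScale u T x₀ r δ ↔
      ∀ θ : ℝ → EuclideanSpace ℝ (Fin 3) → ℝ,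
        Literature.Analysis.FluidPDE.IsSmoothSpaceTimeOn (Set.Icc (T - r ^ 2) (T - r ^ 2 / 2)) θ →
        Literature.Analysis.FluidPDE.HasUniformRapidDecayOn (Set.Icc (T - r ^ 2) (T - r ^ 2 / 2)) θ →
        (∀ t ∈ (Set.Icc (T - r ^ 2) (T - r ^ 2 / 2)), ∀ x : EuclideanSpace ℝ (Fin 3),
          Literature.Analysis.FluidPDE.timeDerivWithin (Set.Icc (T - r ^ 2) (T - r ^ 2 / 2)) θ t x
            + inner ℝ (u t x) (gradient (θ t) x) = Laplacian.laplacian (θ t) x) →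
        Function.support (θ (T - r ^ 2)) ⊆ Metric.ball x₀ r →
        ∫ x, (θ (T - r ^ 2 / 2) x) ^ 2 ≤ δ ^ 2 * ∫ x, (θ (T - r ^ 2) x) ^ 2 :=
  Iff.rfl

/-- Monotonicity of `DissipatesAtScale` in the factor through `δ²`: a drift that dissipates with
factor `δ` dissipates with every factor `δ'` with `δ² ≤ δ'²` (the `L²` mass `∫ θ(T − r²)²` is
nonnegative). [folklore] -/
theorem DissipatesAtScale.mono_sq (h : DissipatesAtScale u T x₀ r δ) (hδ : δ ^ 2 ≤ δ' ^ 2) :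
    DissipatesAtScale u T x₀ r δ' := fun θ hs hd he hsupp =>
  (h θ hs hd he hsupp).trans
    (mul_le_mul_of_nonneg_right hδ (integral_nonneg fun _ => sq_nonneg _))

/-- Monotonicity of `DissipatesAtScale` in the factor: `0 ≤ δ ≤ δ'`. [folklore] -/
theorem DissipatesAtScale.mono (h : DissipatesAtScale u T x₀ r δ) (h₀ : 0 ≤ δ) (hδ : δ ≤ δ') :
    DissipatesAtScale u T x₀ r δ' :=
  h.mono_sq (pow_le_pow_left₀ h₀ hδ 2)

/-- Only `δ²` enters `DissipatesAtScale`: the factors `|δ|` and `δ` give the same predicate. [folklore] -/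
@[simp]
theorem dissipatesAtScale_abs :
    DissipatesAtScale u T x₀ r |δ| ↔ DissipatesAtScale u T x₀ r δ := by
  simp only [DissipatesAtScale, sq_abs]

/-- Only `δ²` enters `DissipatesAtScale`: the factors `-δ` and `δ` give the same predicate. [folklore] -/
@[simp]
theorem dissipatesAtScale_neg :
    DissipatesAtScale u T x₀ r (-δ) ↔ DissipatesAtScale u T x₀ r δ := by
  simp only [DissipatesAtScale, neg_sq]

/-- `DissipatesAtScale u T x₀ r δ` depends on the drift only through its values on the window
`[T − r², T − r²/2] × ℝ³`. [folklore] -/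
theorem DissipatesAtScale.congr (h : DissipatesAtScale u T x₀ r δ)
    (huu' : ∀ t ∈ Set.Icc (T - r ^ 2) (T - r ^ 2 / 2), ∀ x, u t x = u' t x) :
    DissipatesAtScale u' T x₀ r δ := fun θ hs hd he hsupp =>
  h θ hs hd (fun t ht x => by rw [huu' t ht x]; exact he t ht x) hsupp

/-- Two drifts that agree on the window `[T − r², T − r²/2] × ℝ³` dissipate at scale `r` with the
same factors. [folklore] -/
theorem dissipatesAtScale_congr
    (huu' : ∀ t ∈ Set.Icc (T - r ^ 2) (T - r ^ 2 / 2), ∀ x, u t x = u' t x) :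
    DissipatesAtScale u T x₀ r δ ↔ DissipatesAtScale u' T x₀ r δ :=
  ⟨fun h => h.congr huu', fun h => h.congr fun t ht x => (huu' t ht x).symm⟩

/-- Degenerate scale: at `r = 0` the window is `{T}`, the datum must be supported in the empty ball
`Metric.ball x₀ 0`, hence vanishes, and the inequality reads `0 ≤ δ² · 0`; so every drift
dissipates at scale `0` with every factor. (The route only uses `0 < r`.) [folklore] -/
theorem dissipatesAtScale_zero_radius : DissipatesAtScale u T x₀ 0 δ := by
  intro θ _ _ _ hsupp
  have hθ : θ T = 0 := by
    have h0 : Function.support (θ T) ⊆ (∅ : Set (EuclideanSpace ℝ (Fin 3))) := by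
      simpa using hsupp
    exact Function.support_eq_empty_iff.mp (Set.subset_empty_iff.mp h0)
  simp [hθ]

end Literature.Analysis.FluidPDE
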